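import Literature.Barriers.AtomisticToContinuum.AnticontinuumLocalizationEstimates
import HarnessLib

/-!
# De Roeck–Huveneers 2015, Theorem 2 from Theorem 1 (anti-continuum localization barrier, reduction)

Third support file for `Literature/Barriers/AtomisticToContinuum/AnticontinuumLocalization.lean`.
The barrier fact `DeRoeckHuveneers2015_thm2` (Theorem 2 of De Roeck–Huveneers for the rotor chain:
the finite-time Green–Kubo conductivity on every time scale `ε^{-n}t` is `o(ε^m)`, `1 ≤ m < n`) is
proved in the source (§7) in half a page FROM three ingredients, each of which is a theorem of its
own size:

1. Theorem 1 (`DeRoeckHuveneers2015_thm1`, already a named fact of the barrier file; its proof is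
   §§3–6 of the paper, a KAM-type construction): `εJ_{a,a+1} = L_H U_a + ε^{n+1} G_a` with local,
   smooth, zero-mean `U_a, G_a` obeying `⟨U_a²⟩ ≤ Cε^{1/4}`, `⟨(∂U_a)²⟩ ≤ Cε^{-1/4}`, `⟨G_a²⟩, ⟨(∂G_a)²⟩ ≤ C`.
2. Stationarity of the Gibbs state `⟨·⟩_T` under the Hamiltonian flow (Liouville's theorem and
   conservation of energy, on the torus `Ω_N = (𝕋 × ℝ)^N`) — vendored here as the named fact
   `RotorChain.GibbsStationarity`.
3. The decorrelation inequality (7.1) of the Gibbs state at small coupling, imported in the source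
   from Ledoux 2001 — vendored here as the named fact `DeRoeckHuveneers2015_decorrelation`.

This file PROVES the reduction

  `DeRoeckHuveneers2015_thm2_of_thm1 :
     DeRoeckHuveneers2015_thm1 → RotorChain.GibbsStationarity → DeRoeckHuveneers2015_decorrelation →
     DeRoeckHuveneers2015_thm2`,

i.e. the printed proof of Theorem 2 [cite: DeRoeckHuveneers2015, §7], via the one-`(ε, N)` estimate
`finiteTimeConductivity_le` (the chain rule / FTC along the flow of `…Dynamics.lean` and the `L²`
book-keeping of `…Estimates.lean`). Discharging `DeRoeckHuveneers2015_thm2` is thereby reduced to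
discharging the three named facts (trust base of the reduction: none beyond Mathlib).

## Design notes

* `RotorChain.GibbsStationarity` is stated for `[0, ∞]`-valued measurable observables that are
  `2π`-periodic in every angle (functions on `Ω_N`), as an identity of Lebesgue integrals against
  `RotorChain.gibbsMeasure` (the Gibbs state realised on the fundamental domain `[0, 2π)^N × ℝ^N` of
  the lift); this is exactly the form consumed by the proof and avoids integrability side conditions.
  It holds for every flow map satisfying `RotorChain.IsFlow` (Hamilton's equations have unique,
  global solutions for this smooth Hamiltonian with bounded forces, so `IsFlow` pins the flow down).
* `DeRoeckHuveneers2015_decorrelation` is (7.1) in the weaker, implied form the proof uses: the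
  dependence sets `S(f) ⊆ {x : |x - a| ≤ R_f}`, `S(g) ⊆ {x : |x - b| ≤ R_g}` give
  `d(S(f), S(g)) ≥ |a - b| - R_f - R_g`; finiteness of both sides is made explicit by
  square-integrability hypotheses; `gradSqNorm μ f = ⟨|∇f|²⟩`.
* In the source the `𝒰`-term is bounded by `Cε^{-1/2}`; Theorem 1's bounds actually give `Cε^{-1/4}`
  (used here); either way the total is `Cε^{n-m}t⁻¹(ε^{-1/4} + ε²t²) → 0` as `ε → 0` for each fixed
  `t > 0` since `n - m ≥ 1`, so the outer limit `t → ∞` is over an eventually-zero function.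
-/

noncomputable section

open MeasureTheory Filter Topology Set
open scoped ContDiff ENNReal

namespace Literature.Barriers.AtomisticToContinuum

open Literature.MathematicalPhysics.KineticTheory.HeatConduction HeatConduction HeatConduction.RotorChain

/-- The Dirichlet form `⟨|∇f|²⟩_μ = ∑_x (⟨(∂_{q_x} f)²⟩_μ + ⟨(∂_{ω_x} f)²⟩_μ)` appearing in the
decorrelation inequality ("`|∇f|² = ∑_{x ∈ ℤ_N} (|∂_{ω_x} f|² + |∂_{q_x} f|²)` for the rotor chain").
[cite: DeRoeckHuveneers2015, §7 eq. (7.1)] -/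
def HeatConduction.RotorChain.gradSqNorm {N : ℕ} (μ : Measure (PhaseSpace N)) (f : PhaseSpace N → ℝ) : ℝ :=
  ∑ x : Fin N, (∫ z, partialQ x f z ^ 2 ∂μ + ∫ z, partialP x f z ^ 2 ∂μ)

/-- Unfolding `gradSqNorm`. [folklore] -/
theorem HeatConduction.RotorChain.gradSqNorm_def {N : ℕ} (μ : Measure (PhaseSpace N)) (f : PhaseSpace N → ℝ) :
    HeatConduction.RotorChain.gradSqNorm μ f =
      ∑ x : Fin N, (∫ z, partialQ x f z ^ 2 ∂μ + ∫ z, partialP x f z ^ 2 ∂μ) := rfl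

/-- **Stationarity of the Gibbs state of the rotor chain under its Hamiltonian flow.** For every
`N`, coupling `ε`, pinning `γ`, temperature `T > 0`, every flow map `X^t_ε` of Hamilton's equations
of the rotor chain (`RotorChain.IsFlow`, angles lifted to `ℝ^N`) and every measurable observable
`F ≥ 0` on `Ω_N = (𝕋 × ℝ)^N` (a function on the lift, `2π`-periodic in each angle):
`⟨F ∘ X^t_ε⟩_T = ⟨F⟩_T`, i.e. `∫ F(X^t z) μ(dz) = ∫ F dμ` for the Gibbs state
`μ = Z(T)⁻¹ e^{-H/T} dq dω` (`RotorChain.gibbsMeasure`, carried by the fundamental domain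
`[0, 2π)^N × ℝ^N`). This is Liouville's theorem — "The phase flow preserves volume", i.e. the phase
flow of Hamilton's equations preserves `dq dω` [cite: Arnold1978, §16 Thm 1] — combined with
conservation of `H` along the flow (`RotorChain.IsFlow.hamiltonian_apply`) and the
`2πℤ^N`-equivariance of the lifted flow (so that the flow descends to `Ω_N` and the descended flow
preserves the image of `e^{-H/T} dq dω`); it is the "stationarity of the Gibbs measure" / "invariance
of the Gibbs measure" invoked without proof in the proofs of Theorems 2, 3 and 4 of
De Roeck–Huveneers. [cite: DeRoeckHuveneers2015, §7 proofs of Thms 2 and 4] -/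
def HeatConduction.RotorChain.GibbsStationarity : Prop :=
  ∀ (N : ℕ) (ε γ T : ℝ), 0 < T → ∀ Φ : ℝ → PhaseSpace N → PhaseSpace N, IsFlow N ε γ Φ →
    ∀ F : PhaseSpace N → ℝ≥0∞, Measurable F →
      (∀ (z : PhaseSpace N) (x : Fin N), F (Function.update z.1 x (z.1 x + 2 * Real.pi), z.2) = F z) →
      ∀ t : ℝ, ∫⁻ z, F (Φ t z) ∂(gibbsMeasure N T ε γ) = ∫⁻ z, F z ∂(gibbsMeasure N T ε γ)

/-- **De Roeck–Huveneers 2015, eq. (7.1): exponential decorrelation of the Gibbs state of the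
rotor chain** (imported there from Ledoux's exposition of Helffer's covariance bound
[cite: Ledoux2001, Prop. 6.2]: "General results in [Ledoux] apply to the measures corresponding to
the Hamiltonians (2.1) and (2.3), if `ε` is small enough for a given temperature `T`"). For `γ ≥ 0` and `T > 0` "there exist constants `C < +∞` and `c > 0` such that
given two smooth functions `f` and `g` on `Ω` satisfying `⟨f⟩_T = ⟨g⟩_T = 0`, it holds that
`|⟨fg⟩_T| ≤ C e^{-c d(S(f),S(g))} ⟨|∇f|²⟩_T^{1/2} ⟨|∇g|²⟩_T^{1/2}`, where
`|∇f|² = ∑_x (|∂_{ω_x} f|² + |∂_{q_x} f|²)`", `S(f)` being the set of sites `f` depends on and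
`d(A, B) = min {|x - y| : x ∈ A, y ∈ B}`; for all sufficiently small `ε > 0` and all (odd) `N`,
uniformly. Vendored in the implied form used in the proof of Theorem 2: if `f` depends only on
the sites within distance `R_f` of `a` and `g` on those within `R_g` of `b`, then
`d(S(f), S(g)) ≥ |a - b| - R_f - R_g`, whence the bound with `e^{-c(|a - b| - R_f - R_g)}`
(`gradSqNorm μ f = ⟨|∇f|²⟩`); `f, g` are moreover assumed square-integrable with
square-integrable first partials, so that both sides are finite. "Strictly speaking, (7.1) is
stated in [Ledoux] only in the case where the one-site phase space is `ℝ`, but the proof goes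
through without any changes in our case as well … since the only genuine requirement is a
Poincaré inequality for the one-site measure." [cite: DeRoeckHuveneers2015, §7 eq. (7.1)] -/
def DeRoeckHuveneers2015_decorrelation : Prop :=
  ∀ γ : ℝ, 0 ≤ γ → ∀ T : ℝ, 0 < T →
    ∃ Cd c ε₁ : ℝ, 0 < c ∧ 0 < ε₁ ∧ ∀ ε : ℝ, 0 < ε → ε < ε₁ → ∀ N : ℕ, Odd N →
      ∀ (f g : PhaseSpace N → ℝ) (a b : Fin N) (Rf Rg : ℝ),
        ContDiff ℝ ∞ f → ContDiff ℝ ∞ g → IsAnglePeriodic N f → IsAnglePeriodic N g →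
        DependsOnlyNear N a Rf f → DependsOnlyNear N b Rg g →
        Integrable (fun z => f z ^ 2) (gibbsMeasure N T ε γ) →
        Integrable (fun z => g z ^ 2) (gibbsMeasure N T ε γ) →
        (∀ x : Fin N, Integrable (fun z => partialQ x f z ^ 2) (gibbsMeasure N T ε γ) ∧
          Integrable (fun z => partialP x f z ^ 2) (gibbsMeasure N T ε γ)) →
        (∀ x : Fin N, Integrable (fun z => partialQ x g z ^ 2) (gibbsMeasure N T ε γ) ∧
          Integrable (fun z => partialP x g z ^ 2) (gibbsMeasure N T ε γ)) →
        ∫ z, f z ∂(gibbsMeasure N T ε γ) = 0 → ∫ z, g z ∂(gibbsMeasure N T ε γ) = 0 →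
        |∫ z, f z * g z ∂(gibbsMeasure N T ε γ)| ≤
          Cd * Real.exp (-c * (|(a.val : ℝ) - b.val| - Rf - Rg)) *
            Real.sqrt (gradSqNorm (gibbsMeasure N T ε γ) f) *
            Real.sqrt (gradSqNorm (gibbsMeasure N T ε γ) g)

/-- **One-`(ε, N)` estimate of the proof of Theorem 2.** Given the data of Theorem 1 at coupling
`ε` and size `N` (the decomposition `εJ_{a,a+1} = L_H U_a + ε^{n+1} G_a` with smooth periodic
`U_a, G_a`), stationarity of the Gibbs state and bounds `⟨(N^{-1/2}∑U_a)²⟩ ≤ A_U`,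
`⟨(N^{-1/2}∑G_a)²⟩ ≤ A_G`, the quantity of Theorem 2 at time parameter `t` and `τ = ε^{-n} t` is at
most `ε^{-m} T^{-2} (3/τ)(2A_U + ε^{2n+2} τ² A_G)`. [cite: DeRoeckHuveneers2015, §7 proof of Thm 2] -/
theorem finiteTimeConductivity_le (hS : GibbsStationarity) {N : ℕ} {γ T ε : ℝ}
    (hT : 0 < T) (hε : 0 < ε) {n m : ℕ} {Φ : ℝ → PhaseSpace N → PhaseSpace N}
    (hΦ : IsFlow N ε γ Φ) {t : ℝ} (ht : 0 < t) {U G : Fin N → PhaseSpace N → ℝ}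
    (hUs : ∀ a, ContDiff ℝ ∞ (U a)) (hGs : ∀ a, ContDiff ℝ ∞ (G a))
    (hUp : ∀ a, IsAnglePeriodic N (U a)) (hGp : ∀ a, IsAnglePeriodic N (G a))
    (hU2 : ∀ a, Integrable (fun z => U a z ^ 2) (gibbsMeasure N T ε γ))
    (hG2 : ∀ a, Integrable (fun z => G a z ^ 2) (gibbsMeasure N T ε γ))
    (hdec : ∀ a z, ε * bondCurrent N a z = liouville N ε γ (U a) z + ε ^ (n + 1) * G a z)
    {AU AG : ℝ}
    (hAU : ∫ z, ((∑ a, U a z) / Real.sqrt N) ^ 2 ∂(gibbsMeasure N T ε γ) ≤ AU)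
    (hAG : ∫ z, ((∑ a, G a z) / Real.sqrt N) ^ 2 ∂(gibbsMeasure N T ε γ) ≤ AG) :
    finiteTimeConductivity γ T ε n m N Φ t ≤
      ENNReal.ofReal (ε ^ (-(m : ℝ)) / T ^ 2 * (3 / (ε ^ (-(n : ℝ)) * t) *
        (2 * AU + (ε ^ (n + 1)) ^ 2 * (ε ^ (-(n : ℝ)) * t) ^ 2 * AG))) := by
  haveI : SFinite (gibbsMeasure N T ε γ) := by unfold gibbsMeasure; infer_instance
  set μ := gibbsMeasure N T ε γ with hμ
  set τ : ℝ := ε ^ (-(n : ℝ)) * t with hτdef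
  have hτ : 0 < τ := mul_pos (Real.rpow_pos_of_pos hε _) ht
  have hUm : ∀ a, MemLp (U a) 2 μ := fun a =>
    (memLp_two_iff_integrable_sq ((hUs a).continuous.aestronglyMeasurable)).2 (hU2 a)
  have hGm : ∀ a, MemLp (G a) 2 μ := fun a =>
    (memLp_two_iff_integrable_sq ((hGs a).continuous.aestronglyMeasurable)).2 (hG2 a)
  have h𝒰c : Continuous fun z : PhaseSpace N => (∑ a, U a z) / Real.sqrt N :=
    (continuous_finsetSum _ fun a _ => (hUs a).continuous).div_const _
  have h𝒢c : Continuous fun z : PhaseSpace N => (∑ a, G a z) / Real.sqrt N :=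
    (continuous_finsetSum _ fun a _ => (hGs a).continuous).div_const _
  have h𝒰p : IsAnglePeriodic N fun z : PhaseSpace N => (∑ a, U a z) / Real.sqrt N := by
    intro z x
    simp only
    rw [Finset.sum_congr rfl fun a _ => hUp a z x]
  have h𝒢p : IsAnglePeriodic N fun z : PhaseSpace N => (∑ a, G a z) / Real.sqrt N := by
    intro z x
    simp only
    rw [Finset.sum_congr rfl fun a _ => hGp a z x]
  have h𝒰i : Integrable (fun z : PhaseSpace N => ((∑ a, U a z) / Real.sqrt N) ^ 2) μ := by
    simp_rw [div_pow]
    exact (integrable_sq_sum μ U hUm).div_const _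
  have h𝒢i : Integrable (fun z : PhaseSpace N => ((∑ a, G a z) / Real.sqrt N) ^ 2) μ := by
    simp_rw [div_pow]
    exact (integrable_sq_sum μ G hGm).div_const _
  have hid : ∀ z, ε * ∫ s in (0:ℝ)..τ, totalCurrent N (Φ s z) =
      (fun z : PhaseSpace N => (∑ a, U a z) / Real.sqrt N) (Φ τ z) -
        (fun z : PhaseSpace N => (∑ a, U a z) / Real.sqrt N) z +
        ε ^ (n + 1) * ∫ s in (0:ℝ)..τ, (fun z : PhaseSpace N => (∑ a, G a z) / Real.sqrt N) (Φ s z) :=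
    fun z => hΦ.integral_totalCurrent_eq (n := ∞) (by simp) hUs (fun a => (hGs a).continuous) hdec z τ
  have hcore := lintegral_sq_timeAverage_le μ hΦ.1 (hS N ε γ T hT Φ hΦ) h𝒰c h𝒢c h𝒰p h𝒢p h𝒰i h𝒢i
    hτ hid
  have hAU0 : 0 ≤ AU := (integral_nonneg fun z => sq_nonneg _).trans hAU
  have hAG0 : 0 ≤ AG := (integral_nonneg fun z => sq_nonneg _).trans hAG
  unfold finiteTimeConductivity
  calc ENNReal.ofReal (ε ^ (-(m : ℝ)) / T ^ 2) *
        ∫⁻ z, ENNReal.ofReal ((ε / Real.sqrt (ε ^ (-(n : ℝ)) * t) *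
          ∫ s in (0 : ℝ)..(ε ^ (-(n : ℝ)) * t), totalCurrent N (Φ s z)) ^ 2) ∂μ
      ≤ ENNReal.ofReal (ε ^ (-(m : ℝ)) / T ^ 2) * ENNReal.ofReal (3 / τ *
          (2 * ∫ z, ((∑ a, U a z) / Real.sqrt N) ^ 2 ∂μ +
            (ε ^ (n + 1)) ^ 2 * τ ^ 2 * ∫ z, ((∑ a, G a z) / Real.sqrt N) ^ 2 ∂μ)) :=
        mul_le_mul_right hcore _
    _ ≤ ENNReal.ofReal (ε ^ (-(m : ℝ)) / T ^ 2) * ENNReal.ofReal (3 / τ *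
          (2 * AU + (ε ^ (n + 1)) ^ 2 * τ ^ 2 * AG)) := by
        gcongr
    _ = _ := by rw [← ENNReal.ofReal_mul (by positivity)]

/-- **De Roeck–Huveneers 2015, Theorem 2 from Theorem 1 (the printed proof, §7).** Theorem 2 for
the rotor chain follows from the decomposition of the current (Theorem 1,
`DeRoeckHuveneers2015_thm1`), the stationarity of the Gibbs state under the flow
(`RotorChain.GibbsStationarity`) and the decorrelation inequality (7.1)
(`DeRoeckHuveneers2015_decorrelation`): with `τ = ε^{-n}t`,
`ε∫₀^τ 𝒥_N(X^s) ds = 𝒰_N(X^τ) - 𝒰_N + ε^{n+1}∫₀^τ 𝒢_N(X^s) ds` (`𝒰_N = N^{-1/2}∑U_a`,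
`𝒢_N = N^{-1/2}∑G_a`), so `⟨(ε τ^{-1/2}∫₀^τ 𝒥_N(X^s) ds)²⟩ ≤ (3/τ)(2⟨𝒰_N²⟩ + ε^{2n+2}τ²⟨𝒢_N²⟩)`
by stationarity and Jensen; by (7.1), locality and the bounds of Theorem 1,
`⟨𝒰_N²⟩ ≤ K ε^{-1/4}` and `⟨𝒢_N²⟩ ≤ K` uniformly in `N`; hence the quantity of Theorem 2 is
`≤ 3K T⁻² ε^{n-m}(2ε^{-1/4}/t + ε²t)`, which tends to `0` as `ε → 0` for every fixed `t > 0`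
because `n - m ≥ 1` ("Because `n - m > 0`, this quantity goes to zero when taking successively the
limits `N → ∞`, `ε → 0` and `t → ∞`"). [cite: DeRoeckHuveneers2015, §7 proof of Thm 2] -/
theorem DeRoeckHuveneers2015_thm2_of_thm1 (h1 : DeRoeckHuveneers2015_thm1)
    (hS : GibbsStationarity) (hD : DeRoeckHuveneers2015_decorrelation) :
    DeRoeckHuveneers2015_thm2 := by
  intro γ hγ T hT n m hm hmn Φ hΦ
  obtain ⟨C, ε₀, hε₀, hthm1⟩ := h1 γ hγ T hT n (by omega)
  obtain ⟨Cd, c, ε₁, hc, hε₁, hdec⟩ := hD γ hγ T hT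
  -- `C ≥ 0`: instantiate Theorem 1 at `N = 1`
  have hC0 : 0 ≤ C := by
    obtain ⟨U, G, -, -, -, -, -, -, -, -, -, -, -, -, -, -, hGb, -⟩ :=
      hthm1 (ε₀ / 2) (by linarith) (by linarith) 1 odd_one (0 : Fin 1)
    exact (integral_nonneg fun z => sq_nonneg _).trans hGb
  -- it suffices to show that the double `limsup` vanishes for every `t > 0`
  suffices key : ∀ t : ℝ, 0 < t →
      limsup (fun ε : ℝ => limsup (fun N : ℕ => finiteTimeConductivity γ T ε n m N (Φ ε N) t)
        (atTop ⊓ 𝓟 {N | Odd N})) (𝓝[>] 0) = 0 by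
    refine tendsto_const_nhds.congr' ?_
    filter_upwards [eventually_gt_atTop 0] with t ht
    exact (key t ht).symm
  intro t ht
  obtain ⟨d, hd⟩ : ∃ d, n = m + 1 + d := ⟨n - m - 1, by omega⟩
  set S : ℝ := ∑' k : ℤ, Real.exp (-c * |(k : ℝ)|) with hS'
  set K₁ : ℝ := |Cd| * Real.exp (2 * c * C) * (Real.exp (c * C) * S * (2 * C)) * S with hK₁
  have hS0 : 0 ≤ S := tsum_nonneg fun k => (Real.exp_pos _).le
  have hK₁0 : 0 ≤ K₁ := by positivity
  -- the bound at fixed small `ε`, uniform in odd `N`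
  set B : ℝ → ℝ := fun ε => ε ^ (-(m : ℝ)) / T ^ 2 * (3 / (ε ^ (-(n : ℝ)) * t) *
    (2 * (K₁ * ε ^ (-(1 / 4 : ℝ))) + (ε ^ (n + 1)) ^ 2 * (ε ^ (-(n : ℝ)) * t) ^ 2 * K₁)) with hB
  have hbound : ∀ ε, 0 < ε → ε < min ε₀ ε₁ → ∀ N, Odd N →
      finiteTimeConductivity γ T ε n m N (Φ ε N) t ≤ ENNReal.ofReal (B ε) := by
    intro ε hε hε' N hN
    have hεε₀ : ε < ε₀ := hε'.trans_le (min_le_left _ _)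
    have hεε₁ : ε < ε₁ := hε'.trans_le (min_le_right _ _)
    choose U G hUs hGs hUp hGp hUl hGl hUi hGi hU0 hG0 hid hU2i hU2b hG2i hG2b hpart using
      hthm1 ε hε hεε₀ N hN
    set μ := gibbsMeasure N T ε γ with hμ
    have hNpos : (0 : ℝ) < N := by exact_mod_cast hN.pos
    have hUm : ∀ a, MemLp (U a) 2 μ := fun a =>
      (memLp_two_iff_integrable_sq ((hUs a).continuous.aestronglyMeasurable)).2 (hU2i a)
    have hGm : ∀ a, MemLp (G a) 2 μ := fun a =>
      (memLp_two_iff_integrable_sq ((hGs a).continuous.aestronglyMeasurable)).2 (hG2i a)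
    -- Dirichlet-form bounds from the locality and the bounds of Theorem 1
    have hgU : ∀ a, gradSqNorm μ (U a) ≤ Real.exp (c * C) * S * (2 * (C * ε ^ (-(1 / 4 : ℝ)))) :=
      fun a => gradSqNorm_le μ (by positivity) hc (hUl a)
        fun x => ⟨(hpart a x).2.1, (hpart a x).2.2.2.1⟩
    have hgG : ∀ a, gradSqNorm μ (G a) ≤ Real.exp (c * C) * S * (2 * C) :=
      fun a => gradSqNorm_le μ hC0 hc (hGl a)
        fun x => ⟨(hpart a x).2.2.2.2.2.1, (hpart a x).2.2.2.2.2.2.2⟩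
    -- covariance bounds from the decorrelation inequality
    have hcovU : ∀ a b : Fin N, |∫ z, U a z * U b z ∂μ| ≤
        |Cd| * Real.exp (-c * (|(a.val : ℝ) - b.val| - C - C)) *
          Real.sqrt (gradSqNorm μ (U a)) * Real.sqrt (gradSqNorm μ (U b)) := by
      intro a b
      refine (hdec ε hε hεε₁ N hN (U a) (U b) a b C C (hUs a) (hUs b) (hUp a) (hUp b) (hUl a)
        (hUl b) (hU2i a) (hU2i b) (fun x => ⟨(hpart a x).1, (hpart a x).2.2.1⟩)
        (fun x => ⟨(hpart b x).1, (hpart b x).2.2.1⟩) (hU0 a) (hU0 b)).trans ?_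
      gcongr
      exact le_abs_self Cd
    have hcovG : ∀ a b : Fin N, |∫ z, G a z * G b z ∂μ| ≤
        |Cd| * Real.exp (-c * (|(a.val : ℝ) - b.val| - C - C)) *
          Real.sqrt (gradSqNorm μ (G a)) * Real.sqrt (gradSqNorm μ (G b)) := by
      intro a b
      refine (hdec ε hε hεε₁ N hN (G a) (G b) a b C C (hGs a) (hGs b) (hGp a) (hGp b) (hGl a)
        (hGl b) (hG2i a) (hG2i b) (fun x => ⟨(hpart a x).2.2.2.2.1, (hpart a x).2.2.2.2.2.2.1⟩)
        (fun x => ⟨(hpart b x).2.2.2.2.1, (hpart b x).2.2.2.2.2.2.1⟩) (hG0 a) (hG0 b)).trans ?_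
      gcongr
      exact le_abs_self Cd
    -- `⟨𝒰_N²⟩ ≤ K₁ ε^{-1/4}` and `⟨𝒢_N²⟩ ≤ K₁`
    have hSU : ∫ z, ((∑ a, U a z) / Real.sqrt N) ^ 2 ∂μ ≤ K₁ * ε ^ (-(1 / 4 : ℝ)) := by
      have h1 := integral_sq_sum_le μ U hUm (fun a b => |∫ z, U a z * U b z ∂μ|)
        fun a b => le_abs_self _
      have h2 := sum_abs_cov_le μ U (fun a => gradSqNorm μ (U a)) (abs_nonneg Cd) hc
        (D := Real.exp (c * C) * S * (2 * (C * ε ^ (-(1 / 4 : ℝ))))) (by positivity) hcovU hgU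
      have e : ∫ z, ((∑ a, U a z) / Real.sqrt N) ^ 2 ∂μ = (∫ z, (∑ a, U a z) ^ 2 ∂μ) / N := by
        simp_rw [div_pow, Real.sq_sqrt hNpos.le]
        rw [integral_div]
      rw [e, div_le_iff₀ hNpos]
      calc ∫ z, (∑ a, U a z) ^ 2 ∂μ ≤ ∑ a, ∑ b, |∫ z, U a z * U b z ∂μ| := h1
        _ ≤ _ := h2
        _ = K₁ * ε ^ (-(1 / 4 : ℝ)) * N := by simp only [hK₁]; ring
    have hSG : ∫ z, ((∑ a, G a z) / Real.sqrt N) ^ 2 ∂μ ≤ K₁ := by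
      have h1 := integral_sq_sum_le μ G hGm (fun a b => |∫ z, G a z * G b z ∂μ|)
        fun a b => le_abs_self _
      have h2 := sum_abs_cov_le μ G (fun a => gradSqNorm μ (G a)) (abs_nonneg Cd) hc
        (D := Real.exp (c * C) * S * (2 * C)) (by positivity) hcovG hgG
      have e : ∫ z, ((∑ a, G a z) / Real.sqrt N) ^ 2 ∂μ = (∫ z, (∑ a, G a z) ^ 2 ∂μ) / N := by
        simp_rw [div_pow, Real.sq_sqrt hNpos.le]
        rw [integral_div]
      rw [e, div_le_iff₀ hNpos]
      calc ∫ z, (∑ a, G a z) ^ 2 ∂μ ≤ ∑ a, ∑ b, |∫ z, G a z * G b z ∂μ| := h1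
        _ ≤ _ := h2
        _ = K₁ * N := by simp only [hK₁]; ring
    exact finiteTimeConductivity_le hS hT hε (hΦ ε N hε) ht hUs hGs hUp hGp hU2i hG2i hid hSU hSG
  -- the bound tends to `0` as `ε → 0⁺` (here `n - m ≥ 1` is used)
  set B' : ℝ → ℝ := fun ε => 3 / T ^ 2 *
    (2 * K₁ * (ε ^ d * ε ^ (3 / 4 : ℝ)) / t + ε ^ (d + 1) * ε ^ 2 * t * K₁) with hB'
  have hBB' : ∀ ε : ℝ, 0 < ε → B ε = B' ε := by
    intro ε hε
    simp only [hB, hB']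
    have e1 : ε ^ (-(m : ℝ)) = (ε ^ m)⁻¹ := by rw [Real.rpow_neg hε.le, Real.rpow_natCast]
    have e2 : ε ^ (-(n : ℝ)) = (ε ^ n)⁻¹ := by rw [Real.rpow_neg hε.le, Real.rpow_natCast]
    have e3 : ε ^ (3 / 4 : ℝ) = ε * ε ^ (-(1 / 4 : ℝ)) := by
      rw [show (3 / 4 : ℝ) = 1 + -(1 / 4 : ℝ) by norm_num, Real.rpow_add hε, Real.rpow_one]
    have e4pos : 0 < ε ^ (-(1 / 4 : ℝ)) := Real.rpow_pos_of_pos hε _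
    rw [e1, e2, e3, hd]
    field_simp
    ring
  have hB't : Tendsto B' (𝓝[>] 0) (𝓝 0) := by
    have hcont : Continuous B' := by
      simp only [hB']
      have h34 : Continuous fun ε : ℝ => ε ^ (3 / 4 : ℝ) :=
        Real.continuous_rpow_const (by norm_num)
      fun_prop
    have h0 : B' 0 = 0 := by
      simp only [hB']
      rw [Real.zero_rpow (by norm_num), zero_pow (Nat.succ_ne_zero d)]
      simp
    simpa [h0] using (hcont.tendsto 0).mono_left nhdsWithin_le_nhds
  have hBt : Tendsto (fun ε => ENNReal.ofReal (B ε)) (𝓝[>] 0) (𝓝 0) := by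
    rw [← ENNReal.ofReal_zero]
    refine ENNReal.tendsto_ofReal (hB't.congr' ?_)
    filter_upwards [self_mem_nhdsWithin] with ε hε
    exact (hBB' ε hε).symm
  -- conclusion
  have hev : ∀ᶠ ε in 𝓝[>] (0 : ℝ),
      limsup (fun N : ℕ => finiteTimeConductivity γ T ε n m N (Φ ε N) t) (atTop ⊓ 𝓟 {N | Odd N}) ≤
        ENNReal.ofReal (B ε) := by
    filter_upwards [Ioo_mem_nhdsGT (lt_min hε₀ hε₁)] with ε hε
    refine limsup_le_of_le (by isBoundedDefault) ?_
    exact eventually_inf_principal.2 (Eventually.of_forall fun N hN => hbound ε hε.1 hε.2 N hN)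
  refine le_antisymm ?_ bot_le
  calc limsup (fun ε : ℝ => limsup (fun N : ℕ => finiteTimeConductivity γ T ε n m N (Φ ε N) t)
        (atTop ⊓ 𝓟 {N | Odd N})) (𝓝[>] 0)
      ≤ limsup (fun ε => ENNReal.ofReal (B ε)) (𝓝[>] 0) := limsup_le_limsup hev
    _ = 0 := hBt.limsup_eq

end Literature.Barriers.AtomisticToContinuum

end
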